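import Summits.RiemannHypothesis.RiemannHypothesis.Theses.RuelleBand
import Summits.RiemannHypothesis.RiemannHypothesis.Theorems.RuelleBandLadderGlue
import Summits.RiemannHypothesis.RiemannHypothesis.Theorems.CofiniteCriticalLine.Negative.Reformulations

/-!
# `CofiniteToExact` (support item stmt-RiemannHypothesis-14746, route `RuelleBand`) — what the rung is

The glue rung #5 → X of route `RuelleBand` is the route decl

  `CofiniteToExact := CofiniteCriticalLine → ExactFirstBand`,

"if only finitely many zeros of `ζ` in the open critical strip lie off the critical line, then every
zero of the open strip lies on the line or on the real axis".  This support file pins down, kernel-checked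
and over Mathlib's `riemannZeta` only, WHAT the rung says, in the forms in which the literature and the
tree discuss it; nothing here claims the rung (it is open: Bombieri 2000, Thms 10–11 and Corollary, work
under its negation without reaching a contradiction).

* §1 `cofiniteToExact_iff_imp_riemannHypothesis`, `…_iff_fin_imp_riemannHypothesis`,
  `…_iff_rightHalf`, `…_iff_not_finite_and_nonempty`, `…_iff_empty_or_infinite`,
  `…_iff_eventually_imp`, `…_iff_cofinite_iff_riemannHypothesis` — the rung is VERBATIM the dichotomy
  ZOI "zero or infinitely many off-line zeros" of idea card zero-or-infinity-offline (`FIN → RH`), i.e.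
  "Bombieri's standing hypothesis (finitely many off-line zeros, and at least one) is contradictory",
  i.e. "RH above some height is RH", i.e. "under the rung crux #5 has exactly the strength of RH".
* §1b `exactFirstBand_iff_quadrant_empty`, `cofiniteToExact_iff_quadrant` — the smallest arena: "if the
  zeros in the open quadrant `1/2 < re s < 1`, `im s > 0` are finitely many, there are none" (symmetries
  `s ↦ 1 - s`, `s ↦ conj s` of the zero set).
* §2 `cofiniteToExact_of_riemannHypothesis`, `…_of_exactFirstBand`, `…_of_not_cofiniteCriticalLine`,
  `…_of_offLine_infinite` — BOTH WORLDS: the rung holds under RH and also whenever infinitely many zeros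
  are off the line; it is RH-implied but not of the logical shape of RH.
* §3 `not_cofiniteToExact_iff`, `not_cofiniteToExact_iff_exists_finset` — WHAT A REFUTATION IS: a
  complete, non-empty, finite list of the off-line zeros; in particular a refutation of this support item
  refutes RH and PROVES crux #5 (`CofiniteCriticalLine`) at the same time.
* §4 `exactFirstBand_iff_cofinite_and_cofiniteToExact` — the split X ⟺ #5 ∧ (#5 → X) is lossless.

All statements are written out over `riemannZeta`; the inputs are the route file, the refuters' landed
reformulation files (`ExactFirstBand ↔ RiemannHypothesis`, `CofiniteCriticalLine ↔ FIN ↔ RH-above-T`)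
and `ζ(σ) ≠ 0` on `(0,1)` (Titchmarsh §2.12, `ZetaRealAxis`, proved).
-/

-- D-0017: a single-problem summit has `RiemannHypothesis.RiemannHypothesis` in every name by design; the
-- lakefile turns this linter off for `Summits`; repeated here so that standalone elaboration is warning-free.
set_option linter.dupNamespace false

noncomputable section

open Complex Set
open scoped ComplexConjugate

namespace Summit.RiemannHypothesis.RiemannHypothesis.Theorems.CofiniteToExactForms

open Summit.RiemannHypothesis.RiemannHypothesis.Theses.RuelleBand
open Summit.RiemannHypothesis.RiemannHypothesis.Theorems
  (ruelleBand_cofiniteCriticalLine_of_exactFirstBand)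
open Summit.RiemannHypothesis.Cruxes.CofiniteCriticalLine.Negative
  (riemannHypothesis_iff_offLine_eq_empty not_riemannHypothesis_of_not_cofiniteCriticalLine
    cofiniteCriticalLine_iff_rightHalf_finite cofiniteCriticalLine_iff_eventually_on_line
    cofiniteCriticalLine_iff_quadrant_finite)
open Literature.NumberTheory.LFunctions (RiemannHypothesisStrip QuasiRiemannHypothesis
  quasiRiemannHypothesis_one_half_iff_holds riemannHypothesis_iff_strip_holds im_ne_zero_of_riemannZeta_eq_zero)

/-! ## §1 The rung is the dichotomy "zero or infinitely many off-line zeros" -/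

/-- The rung is `#5 → RH`: its conclusion `ExactFirstBand` is Mathlib's `RiemannHypothesis`
(the disjunct `im s = 0` is dead weight, `ζ(σ) ≠ 0` on `(0,1)`, Titchmarsh §2.12). [folklore] -/
theorem cofiniteToExact_iff_imp_riemannHypothesis :
    CofiniteToExact ↔ (CofiniteCriticalLine → RiemannHypothesis) := by
  -- X ⟺ strip form of RH (a strip zero is non-real, `ZetaRealAxis`) ⟺ Mathlib's `RiemannHypothesis`
  -- (`riemannHypothesis_iff_strip_holds`); both steps are also in the refuters' file
  -- `Theorems/ExactFirstBand/Negative/Reformulations` (`exactFirstBand_iff_riemannHypothesis`).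
  have hX : ExactFirstBand ↔ RiemannHypothesis := by
    rw [show RiemannHypothesis ↔ RiemannHypothesisStrip from riemannHypothesis_iff_strip_holds]
    refine ⟨fun h s hs h0 h1 => ?_, fun h s hs h0 h1 => Or.inl (h s hs h0 h1)⟩
    exact (h s hs h0 h1).resolve_right (im_ne_zero_of_riemannZeta_eq_zero hs h0 h1)
  unfold CofiniteToExact
  rw [hX]

/-- The rung is VERBATIM the statement ZOI := FIN → RH of idea card zero-or-infinity-offline
(FIN: finitely many zeros with `1/2 < re s < 1`; the reflection `s ↦ 1 - s` of the zero set takes care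
of the left half). [folklore] -/
theorem cofiniteToExact_iff_fin_imp_riemannHypothesis :
    CofiniteToExact ↔
      ({s : ℂ | riemannZeta s = 0 ∧ 1 / 2 < s.re ∧ s.re < 1}.Finite → RiemannHypothesis) := by
  rw [cofiniteToExact_iff_imp_riemannHypothesis, cofiniteCriticalLine_iff_rightHalf_finite]

/-- One-sided form over `riemannZeta` alone: "if the zeros with `1/2 < re s < 1` are finitely many,
there are none" (`RiemannHypothesis ↔ QuasiRiemannHypothesis (1/2)`, Davenport ch. 8, proved in tree).
[folklore] -/
theorem cofiniteToExact_iff_rightHalf :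
    CofiniteToExact ↔
      ({s : ℂ | riemannZeta s = 0 ∧ 1 / 2 < s.re ∧ s.re < 1}.Finite →
        ∀ s : ℂ, riemannZeta s = 0 → 1 / 2 < s.re → s.re < 1 → False) := by
  rw [cofiniteToExact_iff_fin_imp_riemannHypothesis,
    ← show QuasiRiemannHypothesis (1 / 2) ↔ RiemannHypothesis from
      quasiRiemannHypothesis_one_half_iff_holds]
  rfl

/-- The rung says exactly that the standing hypothesis of Bombieri's Theorems 10–11 — "ζ has only
finitely many non-trivial zeros off the critical line, and at least one" — is contradictory.
[cite: Bombieri2000Weil, Thms 10–11] -/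
theorem cofiniteToExact_iff_not_finite_and_nonempty :
    CofiniteToExact ↔
      ¬ ({s : ℂ | riemannZeta s = 0 ∧ 0 < s.re ∧ s.re < 1 ∧ s.re ≠ 1 / 2}.Finite ∧
          {s : ℂ | riemannZeta s = 0 ∧ 0 < s.re ∧ s.re < 1 ∧ s.re ≠ 1 / 2}.Nonempty) := by
  rw [cofiniteToExact_iff_imp_riemannHypothesis, riemannHypothesis_iff_offLine_eq_empty, not_and,
    Set.not_nonempty_iff_eq_empty]
  rfl

/-- ZOI in words: the set of off-line zeros of the open strip is EMPTY or INFINITE ("off-line zeros come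
in infinite families or not at all"). [folklore] -/
theorem cofiniteToExact_iff_empty_or_infinite :
    CofiniteToExact ↔
      ({s : ℂ | riemannZeta s = 0 ∧ 0 < s.re ∧ s.re < 1 ∧ s.re ≠ 1 / 2} = ∅ ∨
        {s : ℂ | riemannZeta s = 0 ∧ 0 < s.re ∧ s.re < 1 ∧ s.re ≠ 1 / 2}.Infinite) := by
  rw [cofiniteToExact_iff_imp_riemannHypothesis, riemannHypothesis_iff_offLine_eq_empty]
  constructor
  · intro h
    by_cases hf : {s : ℂ | riemannZeta s = 0 ∧ 0 < s.re ∧ s.re < 1 ∧ s.re ≠ 1 / 2}.Finite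
    · exact Or.inl (h hf)
    · exact Or.inr hf
  · rintro (he | hinf) hf
    · exact he
    · exact absurd hf hinf

/-- Height form: the rung is "RH above some height `T` is already RH" (finitely many exceptions ⟺
exceptions of bounded height, since the zeros of `ζ` in a compact set are finitely many). [folklore] -/
theorem cofiniteToExact_iff_eventually_imp :
    CofiniteToExact ↔
      ((∃ T : ℝ, ∀ s : ℂ, riemannZeta s = 0 → 0 < s.re → s.re < 1 → T < |s.im| → s.re = 1 / 2) →
        ∀ s : ℂ, riemannZeta s = 0 → 0 < s.re → s.re < 1 → s.re = 1 / 2) := by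
  have hX : ExactFirstBand ↔ RiemannHypothesisStrip := by
    refine ⟨fun h s hs h0 h1 => ?_, fun h s hs h0 h1 => Or.inl (h s hs h0 h1)⟩
    exact (h s hs h0 h1).resolve_right (im_ne_zero_of_riemannZeta_eq_zero hs h0 h1)
  unfold CofiniteToExact
  rw [cofiniteCriticalLine_iff_eventually_on_line, hX]
  rfl

/-- Under the rung, crux #5 (`CofiniteCriticalLine`) has EXACTLY the strength of RH; and conversely this
equivalence is the rung (`RH → #5` unconditionally: under RH the exceptional set is empty — the refuters'
`not_riemannHypothesis_of_not_cofiniteCriticalLine`, also the sibling file `RuelleBandAsymptoticToCofinite`).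
[folklore] -/
theorem cofiniteToExact_iff_cofinite_iff_riemannHypothesis :
    CofiniteToExact ↔ (CofiniteCriticalLine ↔ RiemannHypothesis) := by
  rw [cofiniteToExact_iff_imp_riemannHypothesis]
  refine ⟨fun h => ⟨h, fun hRH => ?_⟩, fun h => h.1⟩
  by_contra h5
  exact not_riemannHypothesis_of_not_cofiniteCriticalLine h5 hRH

/-! ## §1b The smallest arena: the open quadrant `1/2 < re s < 1`, `0 < im s` -/

/-- Thesis X in the quadrant: `ζ` has no zero with `1/2 < re s < 1` and `0 < im s` (symmetries
`s ↦ 1 - s` — functional equation, tree `GeneralizedRH.riemannZeta_one_sub_eq_zero` — and `s ↦ conj s`,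
Mathlib `riemannZeta_conj`). [cite: Titchmarsh1986, §2.12] -/
theorem exactFirstBand_iff_quadrant_empty :
    ExactFirstBand ↔ ∀ s : ℂ, riemannZeta s = 0 → 1 / 2 < s.re → s.re < 1 → 0 < s.im → False := by
  constructor
  · intro h s hs h12 h1 him
    rcases h s hs (by linarith) h1 with hre | him0
    · linarith
    · linarith
  · intro h s hs h0 h1
    by_contra hnot
    push Not at hnot
    obtain ⟨hne, him⟩ := hnot
    -- any zero with `1/2 < re w < 1` and `im w ≠ 0` contradicts `h` (conjugate if `im w < 0`)
    have key : ∀ w : ℂ, riemannZeta w = 0 → 1 / 2 < w.re → w.re < 1 → w.im ≠ 0 → False := by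
      intro w hw hw12 hw1 hwim
      rcases lt_or_gt_of_ne hwim with hneg | hpos
      · refine h (conj w) ?_ ?_ ?_ ?_
        · rw [riemannZeta_conj, hw, map_zero]
        · simpa using hw12
        · simpa using hw1
        · rw [Complex.conj_im]; linarith
      · exact h w hw hw12 hw1 hpos
    rcases lt_or_gt_of_ne hne with hlt | hgt
    · -- `re s < 1/2`: reflect to `1 - s`
      refine key (1 - s)
        (Literature.NumberTheory.LFunctions.GeneralizedRH.riemannZeta_one_sub_eq_zero hs h0 h1) ?_ ?_ ?_
      · simp only [Complex.sub_re, Complex.one_re]; linarith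
      · simp only [Complex.sub_re, Complex.one_re]; linarith
      · simp only [Complex.sub_im, Complex.one_im, zero_sub, ne_eq, neg_eq_zero]; exact him
    · exact key s hs hgt h1 him

/-- The rung in its smallest arena: "if the zeros of `ζ` in the open quadrant `1/2 < re s < 1`, `im s > 0`
are finitely many, there are none". [folklore] -/
theorem cofiniteToExact_iff_quadrant :
    CofiniteToExact ↔
      ({s : ℂ | riemannZeta s = 0 ∧ 1 / 2 < s.re ∧ s.re < 1 ∧ 0 < s.im}.Finite →
        ∀ s : ℂ, riemannZeta s = 0 → 1 / 2 < s.re → s.re < 1 → 0 < s.im → False) := by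
  unfold CofiniteToExact
  rw [cofiniteCriticalLine_iff_quadrant_finite, exactFirstBand_iff_quadrant_empty]

/-! ## §2 Both worlds: the rung is RH-implied and holds whenever infinitely many zeros are off the line -/

/-- World 1: RH implies the rung. [folklore] -/
theorem cofiniteToExact_of_riemannHypothesis (h : RiemannHypothesis) : CofiniteToExact :=
  cofiniteToExact_iff_imp_riemannHypothesis.2 fun _ => h

/-- In route terms: the crux X (`ExactFirstBand`, stmt-RiemannHypothesis-2061) implies the rung outright —
no mechanism short of X itself is on record (Bombieri: excluding alternative (iii) is "probably quite
difficult"). [cite: Bombieri2000Weil, p.3] -/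
theorem cofiniteToExact_of_exactFirstBand (h : ExactFirstBand) : CofiniteToExact := fun _ => h

/-- World 2: if crux #5 FAILS (infinitely many off-line zeros — a world in which RH is false), the rung
holds vacuously. Hence the rung is not of the logical shape of RH: it is `RH ∨ ¬#5`. [folklore] -/
theorem cofiniteToExact_of_not_cofiniteCriticalLine (h : ¬ CofiniteCriticalLine) : CofiniteToExact :=
  fun h5 => absurd h5 h

/-- World 2 over `riemannZeta`: infinitely many off-line zeros in the open strip imply the rung.
[folklore] -/
theorem cofiniteToExact_of_offLine_infinite
    (h : {s : ℂ | riemannZeta s = 0 ∧ 0 < s.re ∧ s.re < 1 ∧ s.re ≠ 1 / 2}.Infinite) :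
    CofiniteToExact :=
  cofiniteToExact_of_not_cofiniteCriticalLine h

/-- The rung as a disjunction of the two worlds: `RH ∨ ¬#5`. [folklore] -/
theorem cofiniteToExact_iff_riemannHypothesis_or_not_cofinite :
    CofiniteToExact ↔ RiemannHypothesis ∨ ¬ CofiniteCriticalLine := by
  rw [cofiniteToExact_iff_imp_riemannHypothesis, imp_iff_not_or, or_comm]

/-! ## §3 What a refutation of the rung is -/

/-- A refutation of the rung is: crux #5 holds AND RH fails. In particular it is a disproof of RH (so no
counterexample search can succeed short of `¬RH`), and it would PROVE the route's rank-5 crux.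
[folklore] -/
theorem not_cofiniteToExact_iff : ¬ CofiniteToExact ↔ CofiniteCriticalLine ∧ ¬ RiemannHypothesis := by
  rw [cofiniteToExact_iff_imp_riemannHypothesis, Classical.not_imp]

/-- A refutation of the rung refutes RH. [folklore] -/
theorem not_riemannHypothesis_of_not_cofiniteToExact (h : ¬ CofiniteToExact) : ¬ RiemannHypothesis :=
  (not_cofiniteToExact_iff.1 h).2

/-- A refutation of the rung proves crux #5. [folklore] -/
theorem cofiniteCriticalLine_of_not_cofiniteToExact (h : ¬ CofiniteToExact) : CofiniteCriticalLine :=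
  (not_cofiniteToExact_iff.1 h).1

/-- COUNTEREXAMPLE NORMAL FORM: a refutation of the rung is exactly a non-empty `Finset` that is the
COMPLETE list of the off-line zeros of the open strip — no finite computation certifies completeness, which
is why the rung (like crux #5) is not finitely refutable. [folklore] -/
theorem not_cofiniteToExact_iff_exists_finset :
    ¬ CofiniteToExact ↔ ∃ F : Finset ℂ, F.Nonempty ∧
      ∀ s : ℂ, s ∈ F ↔ riemannZeta s = 0 ∧ 0 < s.re ∧ s.re < 1 ∧ s.re ≠ 1 / 2 := by
  rw [cofiniteToExact_iff_not_finite_and_nonempty, not_not]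
  constructor
  · rintro ⟨hfin, hne⟩
    refine ⟨hfin.toFinset, ?_, fun s => ?_⟩
    · simpa using hne
    · simp
  · rintro ⟨F, hne, hF⟩
    have hS : {s : ℂ | riemannZeta s = 0 ∧ 0 < s.re ∧ s.re < 1 ∧ s.re ≠ 1 / 2} = ↑F := by
      ext s
      simp only [mem_setOf_eq, Finset.mem_coe]
      exact (hF s).symm
    rw [hS]
    exact ⟨F.finite_toSet, by simpa using hne⟩

/-! ## §4 The split X ⟺ #5 ∧ (#5 → X) is lossless -/

/-- Thesis X is exactly crux #5 together with this rung (X → #5 is the first half of the route's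
`LadderGlue`). [folklore] -/
theorem exactFirstBand_iff_cofinite_and_cofiniteToExact :
    ExactFirstBand ↔ CofiniteCriticalLine ∧ CofiniteToExact :=
  ⟨fun h => ⟨ruelleBand_cofiniteCriticalLine_of_exactFirstBand h, fun _ => h⟩, fun h => h.2 h.1⟩

/-- Hence, for the route's cone: RH ⟺ #5 ∧ rung. [folklore] -/
theorem riemannHypothesis_iff_cofinite_and_cofiniteToExact :
    RiemannHypothesis ↔ CofiniteCriticalLine ∧ CofiniteToExact :=
  ⟨fun h => ⟨(cofiniteToExact_iff_cofinite_iff_riemannHypothesis.1 (cofiniteToExact_of_riemannHypothesis h)).2 h,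
      cofiniteToExact_of_riemannHypothesis h⟩,
    fun h => cofiniteToExact_iff_imp_riemannHypothesis.1 h.2 h.1⟩

end Summit.RiemannHypothesis.RiemannHypothesis.Theorems.CofiniteToExactForms

end
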